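import Summits.BirchSwinnertonDyer.BirchSwinnertonDyer.Theorems.ClassRecordThreeReg3CertTable1
import Summits.BirchSwinnertonDyer.BirchSwinnertonDyer.Theorems.ClassRecordThreeReg3CertTable2
import Summits.BirchSwinnertonDyer.BirchSwinnertonDyer.Theorems.ClassRecordThreeReg3CertTable3
import Summits.BirchSwinnertonDyer.BirchSwinnertonDyer.Theorems.ClassRecordThreeReg3CertTable4
import Literature.NumberTheory.EllipticCurves.Tamagawa
import HarnessLib

/-!
# Route `ClassRecordThree`, crux `SchneiderAtThree` (item 19106): the REG3CERT FINITE-TABLE CONSUMER — ONE citable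
# theorem over the 723 models of record (cell `bsd-stepL`, seat `bsd-stepL-reg3-eng` g5;
# `--supports stmt-BirchSwinnertonDyer-19106`; Kolyvagin-road twin for item 19154)

HONEST FRAMING: BSD is not proved by any of this; nothing here closes the crux or the rung leaf; Schneider's
non-degeneracy conjecture (barrier `Literature.Barriers.BirchSwinnertonDyer.PAdicHeightNondegeneracy`) — the class-wide
content of `SchneiderAtThree` — is asserted NOWHERE. What this file records is the honest finite reading of the REG3CERT
table (kit j249075 / j249895; cell file `run/shared/lean/pub/bsd-stepL/reg3/REG3CERT-TABLE.md`) now that every row is a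
kernel theorem: for EACH of the 723 globally minimal models of record `Reg3Cert.reg3certModels` (the TRUE-OPEN non-split
(ram) X11b classes at `3` below conductor `5·10⁵`; `Reg3Cert.length_reg3certModels : reg3certModels.length = 723`),
the matrix of the crux holds modulo the PUBLISHED fact GZK:

* `rung_of_mem_reg3certModels : GZK → ∀ W ∈ reg3certModels, ClassX11b W 3 → Ram W 3 → ¬ split(3) →
  ClassClosure.RegulatorNonvanishingAt W 3` (by cases over the four chunks `rung_of_mem_reg3certModels₁…₄`);
* `rungTam_of_mem_reg3certModels` — the Kolyvagin-road twin (crux `SchneiderTamAtThree`, item 19154: the extra binder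
  `3 ∣ ∏ c_ℓ` is not used).

The `∀ W` of the crux ranges over an INFINITE locus; a finite list instantiates it model by model and never discharges
it — membership `W ∈ reg3certModels` is literal equality with a listed model (another minimal model of the same curve is
NOT covered by this statement). Theorems only (0 defs, 0 facts).
References: [SteinWuthrich2013] §4.2 and Conj. 4.1; [Schneider1982PadicHeightI] §1; [KolyvaginEulerSystems1990] Thm. A.
-/

open WeierstrassCurve Literature.NumberTheory.EllipticCurves
  Literature.NumberTheory.EllipticCurves.Rank1Residual
  Summit.BirchSwinnertonDyer.Rank1Residual
  Summit.BirchSwinnertonDyer.Rank1Residual.X11b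
  Summit.BirchSwinnertonDyer.Rank1Residual.X11b.RegMult

namespace Summit.BirchSwinnertonDyer.Rank1Residual.X11b.RegMult.Reg3Cert

/-- **The REG3CERT table as ONE kernel theorem (modulo GZK).** For every globally minimal `W` among the 723 models of
record `reg3certModels` (TRUE-OPEN non-split (ram) X11b classes at `3`, conductor `< 5·10⁵`): from the PUBLISHED fact
GZK (`rank_eq_analyticRank_of_analyticRank_le_one`, rank one on class X11b), `ClassX11b W 3 → Ram W 3 → ¬ split(3) →
ClassClosure.RegulatorNonvanishingAt W 3` — the matrix of crux `SchneiderAtThree` (item 19106) at each listed curve,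
each by its row's kernel-checked certificate (admissible point + non-vanishing Stein–Wuthrich §4.2 height for THE Tate
parameter). A finite conjunction of ONE-curve theorems: Schneider class-wide is asserted nowhere, the crux's `∀` over
the infinite locus is NOT discharged, and nothing is closed by this theorem.
[cite: SteinWuthrich2013, §4.2 and Conj. 4.1] [cite: KolyvaginEulerSystems1990, Thm. A] -/
theorem rung_of_mem_reg3certModels (hGZK : rank_eq_analyticRank_of_analyticRank_le_one) (W : WeierstrassCurve ℚ)
    [W.IsElliptic] [W.IsGloballyMinimal] (hW : W ∈ reg3certModels) :
    ClassX11b W 3 → Ram W 3 → ¬ W.HasSplitMultiplicativeReductionAtPrime 3 →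
      ClassClosure.RegulatorNonvanishingAt W 3 := by
  simp only [reg3certModels, List.mem_append] at hW
  rcases hW with ((h | h) | h) | h
  · exact rung_of_mem_reg3certModels₁ hGZK W h
  · exact rung_of_mem_reg3certModels₂ hGZK W h
  · exact rung_of_mem_reg3certModels₃ hGZK W h
  · exact rung_of_mem_reg3certModels₄ hGZK W h

/-- **Kolyvagin-road twin** (crux `SchneiderTamAtThree`, item 19154): the same finite table with the extra binder
`3 ∣ ∏ c_ℓ`, which is not used. Per listed curve; nothing class-wide; closes nothing by itself.
[cite: SteinWuthrich2013, §4.2 and Conj. 4.1] [cite: KolyvaginEulerSystems1990, Thm. A] -/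
theorem rungTam_of_mem_reg3certModels (hGZK : rank_eq_analyticRank_of_analyticRank_le_one) (W : WeierstrassCurve ℚ)
    [W.IsElliptic] [W.IsGloballyMinimal] (hW : W ∈ reg3certModels) :
    ClassX11b W 3 → Ram W 3 → ¬ W.HasSplitMultiplicativeReductionAtPrime 3 → 3 ∣ W.tamagawaProduct →
      ClassClosure.RegulatorNonvanishingAt W 3 :=
  fun hX hram hns _ => rung_of_mem_reg3certModels hGZK W hW hX hram hns

/-- **Pointwise form over the list** (the shape a finite-table consumer quotes): GZK implies the crux's matrix at every
model of record. Restatement of `rung_of_mem_reg3certModels` with the list quantifier outermost; per listed curve only.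
[cite: SteinWuthrich2013, §4.2 and Conj. 4.1] -/
theorem forall_mem_reg3certModels_rung (hGZK : rank_eq_analyticRank_of_analyticRank_le_one) :
    ∀ W ∈ reg3certModels, ∀ [W.IsElliptic] [W.IsGloballyMinimal],
      ClassX11b W 3 → Ram W 3 → ¬ W.HasSplitMultiplicativeReductionAtPrime 3 →
        ClassClosure.RegulatorNonvanishingAt W 3 :=
  fun W hW _ _ => rung_of_mem_reg3certModels hGZK W hW

end Summit.BirchSwinnertonDyer.Rank1Residual.X11b.RegMult.Reg3Cert
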